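import Mathlib
import Literature.NumberTheory.Irrationality.BrownZudilin2022.GeneralFamily
import HarnessLib

/-!
# Brown–Zudilin 2022, Sect. 3: the dihedral generators, the cubical five-variable form (8), the 12-parameter family (10)–(12)

Source: F. Brown, W. Zudilin, *On cellular rational approximations to `ζ(5)`*, arXiv:2210.03391 (v3, 2026)
[BrownZudilin2022], Section 3 "The associated generalised cellular integrals" (pp. 6–7). Complements
`CellularZetaFive.lean` (`openSimplex`, `integrand`, `cellularIntegral` = the simplicial form (1); `Converges` = (3)) and
`GeneralFamily.lean` (`pOf`, `qOf` = the parameters `(p;q)` of the display after (11); `genI1` = the involution `i₁` of (9)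
acting on `a`). HONEST FRAMING (cell pub-zeta5 / engines group): systematic search; no irrationality claim unless certified;
shared numerical engines serve client cells, rigour lives in the verifiers. Nothing here says anything about the arithmetic
nature of `ζ(5)`.

## Contents (indices of `a : Fin 8 → ℤ` are `0,…,7` for `a₁,…,a₈`; of `x, y, t : Fin 5 → ℝ` are `0,…,4` for `x₁,…,x₅`)

* DATA: the two generators `σ` (`sigmaGen`, "cyclic rotation (of order 8)") and `τ` (`tauGen`, "reflection (of order two)")
  of "the subgroup of automorphisms of `M_{0,8}` … preserving the domain of integration in (1)", "a dihedral group of order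
  16" [Brown2016], and the cubical coordinates `cubicalCoords` (`t₁ = x₁x₂x₃x₄x₅, t₂ = x₂x₃x₄x₅, t₃ = x₃x₄x₅, t₄ = x₄x₅,
  t₅ = x₅`) on the open cube `openCube = (0,1)⁵`. PROVED: `σ` and `τ` preserve the domain of integration (map the open simplex
  `0 < t₁ < ⋯ < t₅ < 1` to itself), `τ ∘ τ = id` there, and the cubical coordinates map `(0,1)⁵` into the open simplex.
* DATA: the five-variable CUBICAL FORM (8) of `I(a)`: the exponents of `x_j` (`xExp`), of `1 − x_j` (`oneSubExp`) and of the
  four "links" `1 − x_jx_{j+1}` (`linkExp`, which stand in the DENOMINATOR of (8) exactly as the `b`'s do in (1)), the integrand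
  `cubicalIntegrand a` (including the trailing factor `x₂x₃x₄/((1−x₁x₂)(1−x₂x₃)(1−x₃x₄)(1−x₄x₅))` of the volume form) and
  `cubicalIntegral a = ∫_{(0,1)⁵} cubicalIntegrand a`. PROVED cross-links: the four link exponents are `b₅₇(a)`, `p₀(a)`, `p₆(a)`
  and `h₂₂(a)` of (26); the `x`/`1−x` exponents are `(q₁, q₁+q₂, p₃, q₄+q₅, q₅)` / `(q₂, p₂, q₃, p₄, q₄)`.
* NAMED FACT `cellularIntegral_eq_cubicalIntegral`: "Applying to the integral `I(a)` … the fifth power of `σ` and passing from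
  simplicial to cubical coordinates … we arrive at the integral `I(a) = ∫_{[0,1]⁵} …` (8)" — statement only (a change of
  variables; the source omits "details of proofs which are either obtainable by finite calculation, or have been verified by
  computer computation", Sect. 1). PROVED alongside: the convergence cone (3) is `i₁`-stable (`converges_genI1_iff`).
* THE INVOLUTION (9): PROVED that `i₁` (`genI1`) acts on the three exponent vectors of (8) by REVERSAL `j ↦ 6 − j`
  (`xExp_genI1`, `oneSubExp_genI1`, `linkExp_genI1`), hence on the integrand by `x_j ↦ x_{6−j}` (`cubicalIntegrand_genI1`)
  and on the integral trivially (`cubicalIntegral_genI1 : cubicalIntegral (i₁ a) = cubicalIntegral a`, by the measure-preserving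
  coordinate reversal `setIntegral_openCube_reverse`), and that `i₁ ∘ i₁ = id` (`genI1_genI1`) — "the involution
  `x_j ↦ x_{6−j}` … does not change the form of the integral but acts on the set of exponents as follows: (9)".
* THE 12-PARAMETER FAMILY (10): the integrand `integrandJ p q` and `Jintegral p q = J(p;q)`, the substitution `substJ`
  (`x = ((1−y₁)/(1−y₁y₂), 1−y₁y₂, y₃, 1−y₄y₅, (1−y₅)/(1−y₄y₅))`, PROVED to map `(0,1)⁵` into `(0,1)⁵`), the constraints (11)
  (`JConstraints`), PROVED for `(p(a); q(a))` (`jConstraints_pOf_qOf`), the printed inverse `aOfPQ` ("conversely, `a₁ = q₄, …,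
  a₈ = p₂ + q₂ − p₀`") with BOTH round trips PROVED (`aOfPQ_pOf_qOf`; `pOf_aOfPQ` under (11), `qOf_aOfPQ`), the lift (12) of
  `i₁` PROVED (`pOf_genI1`, `qOf_genI1`: reversal of `p` and of `q`) together with the corresponding symmetry of the integrand
  (10) under `y_j ↦ y_{6−j}` (`integrandJ_reverse`, and `Jintegral_reverse` for the integral); NAMED FACT
  `cubicalIntegral_eq_Jintegral`: the substitution "transforms the 8-parameter integral `I(a)` into a subfamily of the …
  12-parameter integrals", namely `J(p(a); q(a))`.

## Remarks (finite calculations redone by the cell's engines; NOT used by any declaration below)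
By exact rational arithmetic one checks pointwise that
`integrand a (σ⁵(c(x))) · |det D(σ⁵∘c)(x)| = cubicalIntegrand a x`, where `c = cubicalCoords` and
`σ⁵∘c (x) = (x₄(1−x₃)(1−x₅)/((1−x₃x₄)(1−x₄x₅)), x₄(1−x₃)/(1−x₃x₄), (1−x₃)/(1−x₃x₄),
(1−x₃)(1−x₁x₂x₃x₄)/((1−x₁x₂x₃)(1−x₃x₄)), (1−x₃)(1−x₂x₃x₄)/((1−x₂x₃)(1−x₃x₄)))`,
`det D(σ⁵∘c) = −x₂x₃²x₄(1−x₃)⁴(1−x₄)⁴/((1−x₁x₂x₃)²(1−x₂x₃)²(1−x₃x₄)⁶(1−x₄x₅)²)`, that no other element of the dihedral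
group `⟨σ, τ⟩` turns (1) into (8) in these coordinates, and likewise that
`cubicalIntegrand a (substJ y) · det D(substJ)(y) = integrandJ (p(a)) (q(a)) y` with
`det D(substJ) = y₁y₅/((1−y₁y₂)(1−y₄y₅)) > 0`. These pointwise identities (and the change-of-variables theorem) are
exactly what the two named facts below leave unformalised.

## Deliberately NOT here
The order of `σ` (8) and the structure of `⟨σ, τ⟩`; the `G ≅ S₇` action (Sect. 7, `GeneralFamily.lean`); the leading
coefficient (17) (`GeneralFamily.Qcoeff`); any evaluation of (8) (the totally symmetric values are `Zudilin2002`, Sect. 2 is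
`TotallySymmetric*.lean`).
-/

noncomputable section

open MeasureTheory

namespace Literature.NumberTheory.Irrationality.BrownZudilin2022

/-! ### The dihedral generators in simplicial coordinates (Sect. 3, p. 6) -/

/-- `σ : (t₁,t₂,t₃,t₄,t₅) ↦ (1 − t₁/t₂, 1 − t₁/t₃, 1 − t₁/t₄, 1 − t₁/t₅, 1 − t₁)`, the "cyclic rotation … (of order 8)" which,
with the reflection `τ`, generates "the subgroup of automorphisms of `M_{0,8}` … preserving the domain of integration in (1)",
"a dihedral group of order 16" ("The group however does not preserve the form of the integrand").
[cite: BrownZudilin2022, Sect. 3 (p. 6, display for σ)] -/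
def sigmaGen (t : Fin 5 → ℝ) : Fin 5 → ℝ :=
  ![1 - t 0 / t 1, 1 - t 0 / t 2, 1 - t 0 / t 3, 1 - t 0 / t 4, 1 - t 0]

/-- `τ : (t₁,t₂,t₃,t₄,t₅) ↦ (t₁, t₁/t₅, t₁/t₄, t₁/t₃, t₁/t₂)`, the "reflection (of order two)".
[cite: BrownZudilin2022, Sect. 3 (p. 6, display for τ)] -/
def tauGen (t : Fin 5 → ℝ) : Fin 5 → ℝ :=
  ![t 0, t 0 / t 4, t 0 / t 3, t 0 / t 2, t 0 / t 1]

/-- `σ` preserves the domain of integration of (1): it maps the open simplex `0 < t₁ < ⋯ < t₅ < 1` to itself.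
[cite: BrownZudilin2022, Sect. 3 (p. 6)] -/
theorem sigmaGen_mem_openSimplex {t : Fin 5 → ℝ} (ht : t ∈ openSimplex) : sigmaGen t ∈ openSimplex := by
  obtain ⟨h0, h01, h12, h23, h34, h45⟩ := ht
  have h1 : 0 < t 1 := h0.trans h01
  have h2 : 0 < t 2 := h1.trans h12
  have h3 : 0 < t 3 := h2.trans h23
  have h4 : 0 < t 4 := h3.trans h34
  simp only [openSimplex, Set.mem_setOf_eq, sigmaGen, Matrix.cons_val_zero, Matrix.cons_val_one, Matrix.cons_val]
  refine ⟨?_, ?_, ?_, ?_, ?_, ?_⟩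
  · rw [sub_pos, div_lt_one h1]; exact h01
  · exact sub_lt_sub_left (div_lt_div_of_pos_left h0 h1 h12) 1
  · exact sub_lt_sub_left (div_lt_div_of_pos_left h0 h2 h23) 1
  · exact sub_lt_sub_left (div_lt_div_of_pos_left h0 h3 h34) 1
  · have : t 0 < t 0 / t 4 := by
      rw [lt_div_iff₀ h4]; nlinarith
    linarith
  · linarith

/-- `τ` preserves the domain of integration of (1): it maps the open simplex `0 < t₁ < ⋯ < t₅ < 1` to itself.
[cite: BrownZudilin2022, Sect. 3 (p. 6)] -/
theorem tauGen_mem_openSimplex {t : Fin 5 → ℝ} (ht : t ∈ openSimplex) : tauGen t ∈ openSimplex := by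
  obtain ⟨h0, h01, h12, h23, h34, h45⟩ := ht
  have h1 : 0 < t 1 := h0.trans h01
  have h2 : 0 < t 2 := h1.trans h12
  have h3 : 0 < t 3 := h2.trans h23
  have h4 : 0 < t 4 := h3.trans h34
  simp only [openSimplex, Set.mem_setOf_eq, tauGen, Matrix.cons_val_zero, Matrix.cons_val_one, Matrix.cons_val]
  refine ⟨h0, ?_, ?_, ?_, ?_, ?_⟩
  · rw [lt_div_iff₀ h4]; nlinarith
  · exact div_lt_div_of_pos_left h0 h3 h34
  · exact div_lt_div_of_pos_left h0 h2 h23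
  · exact div_lt_div_of_pos_left h0 h1 h12
  · rw [div_lt_one h1]; exact h01

/-- `τ` is an involution on the open simplex ("reflection (of order two)"). [cite: BrownZudilin2022, Sect. 3 (p. 6)] -/
theorem tauGen_tauGen {t : Fin 5 → ℝ} (ht : t ∈ openSimplex) : tauGen (tauGen t) = t := by
  obtain ⟨h0, h01, h12, h23, h34, h45⟩ := ht
  have h0' : t 0 ≠ 0 := h0.ne'
  ext i
  fin_cases i <;> simp [tauGen, div_div_cancel₀ h0']

/-! ### Cubical coordinates (Sect. 3, p. 6) -/

/-- The open unit cube `(0,1)⁵` (the interior of the printed domain `[0,1]⁵` of (8) and (10)). [cite: BrownZudilin2022, Sect. 3 eq. (8)] -/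
def openCube : Set (Fin 5 → ℝ) :=
  {x | ∀ i, 0 < x i ∧ x i < 1}

/-- The cubical coordinates: "passing from simplicial to cubical coordinates `t₁ = x₁x₂x₃x₄x₅, t₂ = x₂x₃x₄x₅, t₃ = x₃x₄x₅,
t₄ = x₄x₅, t₅ = x₅`" (products right-nested: `t₁ = x₁(x₂(x₃(x₄x₅)))`, etc.). [cite: BrownZudilin2022, Sect. 3 (p. 6)] -/
def cubicalCoords (x : Fin 5 → ℝ) : Fin 5 → ℝ :=
  ![x 0 * (x 1 * (x 2 * (x 3 * x 4))), x 1 * (x 2 * (x 3 * x 4)), x 2 * (x 3 * x 4), x 3 * x 4, x 4]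

/-- The cubical coordinates map the open cube `(0,1)⁵` into the open simplex `0 < t₁ < ⋯ < t₅ < 1`.
[cite: BrownZudilin2022, Sect. 3 (p. 6)] -/
theorem cubicalCoords_mem_openSimplex {x : Fin 5 → ℝ} (hx : x ∈ openCube) : cubicalCoords x ∈ openSimplex := by
  have h0 := hx 0; have h1 := hx 1; have h2 := hx 2; have h3 := hx 3; have h4 := hx 4
  have p34 : 0 < x 3 * x 4 := mul_pos h3.1 h4.1
  have p234 : 0 < x 2 * (x 3 * x 4) := mul_pos h2.1 p34
  have p1234 : 0 < x 1 * (x 2 * (x 3 * x 4)) := mul_pos h1.1 p234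
  simp only [openSimplex, Set.mem_setOf_eq, cubicalCoords, Matrix.cons_val_zero, Matrix.cons_val_one, Matrix.cons_val]
  exact ⟨mul_pos h0.1 p1234, mul_lt_of_lt_one_left p1234 h0.2, mul_lt_of_lt_one_left p234 h1.2,
    mul_lt_of_lt_one_left p34 h2.2, mul_lt_of_lt_one_left h4.1 h3.2, h4.2⟩

/-- The change of variables `x_j ↦ x_{6−j}`, `j = 1,…,5` (used twice in Sect. 3: for (9) on the form (8), and as
`y_j ↦ y_{6−j}` for (12) on the form (10)), made explicit for an arbitrary integrand on `(0,1)⁵`: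
`∫_{(0,1)⁵} g(x₅,x₄,x₃,x₂,x₁) dx = ∫_{(0,1)⁵} g(x) dx` — the coordinate reversal is a measure-preserving involution of the cube
(the permutation `Fin.revPerm` of coordinates, `MeasureTheory.volume_measurePreserving_piCongrLeft`); no integrability
hypothesis is needed (both sides are junk `0` together). [cite: BrownZudilin2022, Sect. 3 (the changes of variables for (9) and (12))] -/
theorem setIntegral_openCube_reverse (g : (Fin 5 → ℝ) → ℝ) :
    ∫ x in openCube, g ![x 4, x 3, x 2, x 1, x 0] = ∫ x in openCube, g x := by
  let e : (Fin 5 → ℝ) ≃ᵐ (Fin 5 → ℝ) := MeasurableEquiv.piCongrLeft (fun _ : Fin 5 => ℝ) Fin.revPerm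
  have he : ∀ x : Fin 5 → ℝ, (e x : Fin 5 → ℝ) = ![x 4, x 3, x 2, x 1, x 0] := by
    intro x; ext i
    simp only [e, MeasurableEquiv.coe_piCongrLeft, Equiv.piCongrLeft_apply_eq_cast, cast_eq, Fin.revPerm_symm,
      Fin.revPerm_apply]
    fin_cases i <;> rfl
  have hmp : MeasurePreserving e volume volume :=
    volume_measurePreserving_piCongrLeft (fun _ : Fin 5 => ℝ) Fin.revPerm
  have hpre : e ⁻¹' openCube = openCube := by
    ext x
    simp only [Set.mem_preimage, openCube, Set.mem_setOf_eq, he]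
    constructor
    · intro h i
      fin_cases i
      · exact h 4
      · exact h 3
      · exact h 2
      · exact h 1
      · exact h 0
    · intro h i
      fin_cases i
      · exact h 4
      · exact h 3
      · exact h 2
      · exact h 1
      · exact h 0
  have key := hmp.setIntegral_preimage_emb e.measurableEmbedding g openCube
  rw [hpre] at key
  simpa only [he] using key

/-! ### The cubical five-variable form (8) -/

/-- The exponents of `x₁,…,x₅` in (8): `(a₄, a₄+a₅, a₂+a₃+a₆−a₈, a₁+a₂, a₂)`. [cite: BrownZudilin2022, Sect. 3 eq. (8)] -/
def xExp (a : Fin 8 → ℤ) : Fin 5 → ℤ :=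
  ![a 3, a 3 + a 4, a 1 + a 2 + a 5 - a 7, a 0 + a 1, a 1]

/-- The exponents of `1−x₁,…,1−x₅` in (8): `(a₅, a₆, a₁+a₅−a₃, a₇, a₁)`. [cite: BrownZudilin2022, Sect. 3 eq. (8)] -/
def oneSubExp (a : Fin 8 → ℤ) : Fin 5 → ℤ :=
  ![a 4, a 5, a 0 + a 4 - a 2, a 6, a 0]

/-- The exponents of the four links `1−x₁x₂, 1−x₂x₃, 1−x₃x₄, 1−x₄x₅` in the DENOMINATOR of (8):
`(a₄+a₅+a₈−a₂−a₃, a₅+a₆−a₈, a₁+a₂+a₆−a₄−a₈, a₁+a₇+a₈−a₃−a₆)`. [cite: BrownZudilin2022, Sect. 3 eq. (8)] -/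
def linkExp (a : Fin 8 → ℤ) : Fin 4 → ℤ :=
  ![a 3 + a 4 + a 7 - a 1 - a 2, a 4 + a 5 - a 7, a 0 + a 1 + a 5 - a 3 - a 7, a 0 + a 6 + a 7 - a 2 - a 5]

/-- The four link exponents of (8) are, in order, `b₅₇(a)` of (2), `p₀(a)` and `p₆(a)` of (11), and `h₂₂(a)` of (26)
(definitional cross-check against `CellularZetaFive.b57`, `GeneralFamily.pOf`, `GeneralFamily.hForm`).
[cite: BrownZudilin2022, Sect. 3 eq. (8), (11); Sect. 7 eq. (26)] -/
theorem linkExp_eq (a : Fin 8 → ℤ) :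
    linkExp a 0 = b57 a ∧ linkExp a 1 = pOf a 0 ∧ linkExp a 2 = pOf a 6 ∧ linkExp a 3 = hForm a 22 := by
  simp [linkExp, b57, pOf, hForm, hList]

/-- The `x`- and `(1−x)`-exponents of (8) in terms of `(p;q)` of (11): `(q₁, q₁+q₂, p₃, q₄+q₅, q₅)` and `(q₂, p₂, q₃, p₄, q₄)`
(so that the substitution before (10) produces the exponents of (10)). [cite: BrownZudilin2022, Sect. 3 eq. (8), (10), (11)] -/
theorem xExp_oneSubExp_eq (a : Fin 8 → ℤ) :
    xExp a = ![qOf a 0, qOf a 0 + qOf a 1, pOf a 3, qOf a 3 + qOf a 4, qOf a 4]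
    ∧ oneSubExp a = ![qOf a 1, pOf a 2, qOf a 2, pOf a 4, qOf a 3] := by
  constructor
  · ext i; fin_cases i <;> simp [xExp, pOf, qOf]
  · ext i; fin_cases i <;> simp [oneSubExp, pOf, qOf]

/-- The integrand of the CUBICAL FORM (8) of `I(a)` on `(0,1)⁵`:
`∏ⱼ x_j^{xExp_j} (1−x_j)^{oneSubExp_j} / ∏_L (1−x_Lx_{L+1})^{linkExp_L} · x₂x₃x₄/((1−x₁x₂)(1−x₂x₃)(1−x₃x₄)(1−x₄x₅))`
(integer powers `zpow`; the last factor is the printed `x₂x₃x₄ dx₁⋯dx₅/((1−x₁x₂)(1−x₂x₃)(1−x₃x₄)(1−x₄x₅))`).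
[cite: BrownZudilin2022, Sect. 3 eq. (8)] -/
def cubicalIntegrand (a : Fin 8 → ℤ) (x : Fin 5 → ℝ) : ℝ :=
  (x 0) ^ (xExp a 0) * (1 - x 0) ^ (oneSubExp a 0) * (x 1) ^ (xExp a 1) * (1 - x 1) ^ (oneSubExp a 1) *
        (x 2) ^ (xExp a 2) * (1 - x 2) ^ (oneSubExp a 2) * (x 3) ^ (xExp a 3) * (1 - x 3) ^ (oneSubExp a 3) *
        (x 4) ^ (xExp a 4) * (1 - x 4) ^ (oneSubExp a 4) /
      ((1 - x 0 * x 1) ^ (linkExp a 0) * (1 - x 1 * x 2) ^ (linkExp a 1) * (1 - x 2 * x 3) ^ (linkExp a 2) *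
        (1 - x 3 * x 4) ^ (linkExp a 3)) *
    (x 1 * x 2 * x 3 / ((1 - x 0 * x 1) * (1 - x 1 * x 2) * (1 - x 2 * x 3) * (1 - x 3 * x 4)))

/-- The cubical integral: the right-hand side of (8), `∫_{(0,1)⁵} cubicalIntegrand a` (Bochner integral for the product
Lebesgue measure; junk value `0` when not integrable). [cite: BrownZudilin2022, Sect. 3 eq. (8)] -/
def cubicalIntegral (a : Fin 8 → ℤ) : ℝ :=
  ∫ x in openCube, cubicalIntegrand a x

/-- **(8) as a NAMED FACT** (statement only): "Applying to the integral `I(a) = I(a₁, …, a₈)` the fifth power of `σ` and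
passing from simplicial to cubical coordinates `t₁ = x₁x₂x₃x₄x₅, t₂ = x₂x₃x₄x₅, t₃ = x₃x₄x₅, t₄ = x₄x₅, t₅ = x₅`, we arrive at
the integral `I(a) = ∫⋯∫_{[0,1]⁵} …` (8)" — for every parameter vector in the convergence cone (3), the simplicial integral (1)
equals the cubical integral (8). The change of variables and its Jacobian are a finite calculation omitted in the source
(Sect. 1) and not formalised here. [cite: BrownZudilin2022, Sect. 3 eq. (8)] -/
def cellularIntegral_eq_cubicalIntegral : Prop :=
  ∀ a : Fin 8 → ℤ, Converges a → cellularIntegral a = cubicalIntegral a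

/-! ### The involution (9) -/

/-- `i₁ ∘ i₁ = id` on parameter vectors ("the involution … `i₁`"); Literature-side copy of a fact the cell also proved
summit-side (`Summit.KontsevichZagierPeriods.Zeta5Search.WedgeDictionary.genI1_invol`, which Literature files cannot import).
[cite: BrownZudilin2022, Sect. 3 eq. (9)] -/
theorem genI1_genI1 (a : Fin 8 → ℤ) : genI1 (genI1 a) = a := by
  ext i; fin_cases i <;> (simp [genI1]; try ring)

/-- `i₁` REVERSES the `x`-exponents of (8): `xExp (i₁ a) = (xExp a)₅,…,(xExp a)₁`. [cite: BrownZudilin2022, Sect. 3 eq. (8)–(9)] -/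
theorem xExp_genI1 (a : Fin 8 → ℤ) : xExp (genI1 a) = ![xExp a 4, xExp a 3, xExp a 2, xExp a 1, xExp a 0] := by
  ext i; fin_cases i <;> simp [xExp, genI1] <;> ring

/-- `i₁` REVERSES the `(1−x)`-exponents of (8). [cite: BrownZudilin2022, Sect. 3 eq. (8)–(9)] -/
theorem oneSubExp_genI1 (a : Fin 8 → ℤ) :
    oneSubExp (genI1 a) = ![oneSubExp a 4, oneSubExp a 3, oneSubExp a 2, oneSubExp a 1, oneSubExp a 0] := by
  ext i; fin_cases i <;> (simp [oneSubExp, genI1]; try ring)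

/-- `i₁` REVERSES the link exponents of (8). [cite: BrownZudilin2022, Sect. 3 eq. (8)–(9)] -/
theorem linkExp_genI1 (a : Fin 8 → ℤ) : linkExp (genI1 a) = ![linkExp a 3, linkExp a 2, linkExp a 1, linkExp a 0] := by
  ext i; fin_cases i <;> simp [linkExp, genI1] <;> ring

/-- "In this representation, the involution `x_j ↦ x_{6−j}` for `j = 1,…,5` does not change the form of the integral but acts
on the set of exponents as (9)": pointwise, the integrand of (8) at `i₁ a` is the integrand at `a` composed with the
coordinate reversal. [cite: BrownZudilin2022, Sect. 3 eq. (8)–(9)] -/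
theorem cubicalIntegrand_genI1 (a : Fin 8 → ℤ) (x : Fin 5 → ℝ) :
    cubicalIntegrand (genI1 a) x = cubicalIntegrand a ![x 4, x 3, x 2, x 1, x 0] := by
  rw [cubicalIntegrand, cubicalIntegrand, xExp_genI1, oneSubExp_genI1, linkExp_genI1]
  simp only [Matrix.cons_val_zero, Matrix.cons_val_one, Matrix.cons_val]
  have e1 : (1 : ℝ) - x 1 * x 0 = 1 - x 0 * x 1 := by ring
  have e2 : (1 : ℝ) - x 2 * x 1 = 1 - x 1 * x 2 := by ring
  have e3 : (1 : ℝ) - x 3 * x 2 = 1 - x 2 * x 3 := by ring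
  have e4 : (1 : ℝ) - x 4 * x 3 = 1 - x 3 * x 4 := by ring
  rw [e1, e2, e3, e4]
  ring

/-- The convergence cone (3) is stable under `i₁` — the seventeen forms (3) of `i₁ a` are those of `a` permuted — so (9)
permutes the convergent integrals (8) among themselves. [cite: BrownZudilin2022, Sect. 1 eq. (3); Sect. 3 eq. (9)] -/
theorem converges_genI1_iff (a : Fin 8 → ℤ) : Converges (genI1 a) ↔ Converges a := by
  simp only [Converges, convergenceForms, genI1, List.mem_cons, List.not_mem_nil, or_false, forall_eq_or_imp, forall_eq,
    Matrix.cons_val_zero, Matrix.cons_val_one, Matrix.cons_val]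
  constructor <;> rintro ⟨h1, h2, h3, h4, h5, h6, h7, h8, h9, h10, h11, h12, h13, h14, h15, h16, h17⟩ <;>
    refine ⟨?_, ?_, ?_, ?_, ?_, ?_, ?_, ?_, ?_, ?_, ?_, ?_, ?_, ?_, ?_, ?_, ?_⟩ <;> omega

/-- Hence `I(i₁ a) = I(a)` for the cubical form (8): "the involution `x_j ↦ x_{6−j}` … does not change the form of the
integral" (for every `a`; both sides are the same Bochner integral after the measure-preserving coordinate reversal).
[cite: BrownZudilin2022, Sect. 3 eq. (8)–(9)] -/
theorem cubicalIntegral_genI1 (a : Fin 8 → ℤ) : cubicalIntegral (genI1 a) = cubicalIntegral a := by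
  unfold cubicalIntegral
  simp_rw [cubicalIntegrand_genI1]
  exact setIntegral_openCube_reverse (cubicalIntegrand a)

/-! ### The 12-parameter family (10), the constraints (11) and the lift (12) -/

/-- The integrand of the 12-parameter integral (10):
`y₁^{p₁}(1−y₁)^{q₁} y₂^{p₂}(1−y₂)^{q₂} y₃^{p₃+1}(1−y₃)^{q₃} y₄^{p₄}(1−y₄)^{q₄} y₅^{p₅}(1−y₅)^{q₅}
 / ((1−y₃(1−y₁y₂))^{p₀+1} (1−y₃(1−y₄y₅))^{p₆+1})` (`p = (p₀,…,p₆)`, `q = (q₁,…,q₅)` with entry `j` of `q` being `q_{j+1}`,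
as in `GeneralFamily.qOf`). [cite: BrownZudilin2022, Sect. 3 eq. (10)] -/
def integrandJ (p : Fin 7 → ℤ) (q : Fin 5 → ℤ) (y : Fin 5 → ℝ) : ℝ :=
  (y 0) ^ (p 1) * (1 - y 0) ^ (q 0) * (y 1) ^ (p 2) * (1 - y 1) ^ (q 1) * (y 2) ^ (p 3 + 1) * (1 - y 2) ^ (q 2) *
      (y 3) ^ (p 4) * (1 - y 3) ^ (q 3) * (y 4) ^ (p 5) * (1 - y 4) ^ (q 4) /
    ((1 - y 2 * (1 - y 0 * y 1)) ^ (p 0 + 1) * (1 - y 2 * (1 - y 3 * y 4)) ^ (p 6 + 1))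

/-- `J(p;q) = ∫_{(0,1)⁵} integrandJ p q` — "the following 12-parameter integrals which have only two rational factors in their
denominator" (Bochner integral; junk value `0` when not integrable). [cite: BrownZudilin2022, Sect. 3 eq. (10)] -/
def Jintegral (p : Fin 7 → ℤ) (q : Fin 5 → ℤ) : ℝ :=
  ∫ y in openCube, integrandJ p q y

/-- The substitution `x = ((1−y₁)/(1−y₁y₂), 1−y₁y₂, y₃, 1−y₄y₅, (1−y₅)/(1−y₄y₅))` turning (8) into (10).
[cite: BrownZudilin2022, Sect. 3 (display before (10))] -/
def substJ (y : Fin 5 → ℝ) : Fin 5 → ℝ :=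
  ![(1 - y 0) / (1 - y 0 * y 1), 1 - y 0 * y 1, y 2, 1 - y 3 * y 4, (1 - y 4) / (1 - y 3 * y 4)]

/-- The substitution maps the open cube `(0,1)⁵` into itself. [cite: BrownZudilin2022, Sect. 3 (display before (10))] -/
theorem substJ_mem_openCube {y : Fin 5 → ℝ} (hy : y ∈ openCube) : substJ y ∈ openCube := by
  have h0 := hy 0; have h1 := hy 1; have h2 := hy 2; have h3 := hy 3; have h4 := hy 4
  have d01 : 0 < 1 - y 0 * y 1 := by nlinarith [mul_lt_of_lt_one_right h0.1 h1.2, h0.2]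
  have d34 : 0 < 1 - y 3 * y 4 := by nlinarith [mul_lt_of_lt_one_left h4.1 h3.2, h4.2]
  have c0 : 0 < (1 - y 0) / (1 - y 0 * y 1) ∧ (1 - y 0) / (1 - y 0 * y 1) < 1 :=
    ⟨div_pos (by linarith [h0.2]) d01, by rw [div_lt_one d01]; nlinarith [mul_lt_of_lt_one_right h0.1 h1.2]⟩
  have c1 : 0 < 1 - y 0 * y 1 ∧ 1 - y 0 * y 1 < 1 := ⟨d01, by nlinarith [mul_pos h0.1 h1.1]⟩
  have c3 : 0 < 1 - y 3 * y 4 ∧ 1 - y 3 * y 4 < 1 := ⟨d34, by nlinarith [mul_pos h3.1 h4.1]⟩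
  have c4 : 0 < (1 - y 4) / (1 - y 3 * y 4) ∧ (1 - y 4) / (1 - y 3 * y 4) < 1 :=
    ⟨div_pos (by linarith [h4.2]) d34, by rw [div_lt_one d34]; nlinarith [mul_lt_of_lt_one_left h4.1 h3.2]⟩
  intro i
  fin_cases i
  · exact c0
  · exact c1
  · exact h2
  · exact c3
  · exact c4

/-- The constraints (11) under which a 12-parameter integral `J(p;q)` "reduces to `I(a)`":
`p₁ = p₀+q₄+q₅−q₁−q₃, p₃ = p₀+q₄+q₅−q₃, p₅ = p₀+q₄−q₃, p₆ = p₀+q₄+q₅−q₁−q₂`. [cite: BrownZudilin2022, Sect. 3 eq. (11)] -/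
def JConstraints (p : Fin 7 → ℤ) (q : Fin 5 → ℤ) : Prop :=
  p 1 = p 0 + q 3 + q 4 - q 0 - q 2 ∧ p 3 = p 0 + q 3 + q 4 - q 2 ∧ p 5 = p 0 + q 3 - q 2 ∧
    p 6 = p 0 + q 3 + q 4 - q 0 - q 1

/-- The parameters `(p(a); q(a))` attached to `a` satisfy (11). [cite: BrownZudilin2022, Sect. 3 eq. (11)] -/
theorem jConstraints_pOf_qOf (a : Fin 8 → ℤ) : JConstraints (pOf a) (qOf a) := by
  refine ⟨?_, ?_, ?_, ?_⟩ <;> simp [pOf, qOf] <;> ring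

/-- The printed inverse: "conversely, `a₁ = q₄, a₂ = q₅, a₃ = q₂+q₄−q₃, a₄ = q₁, a₅ = q₂, a₆ = p₂, a₇ = p₄, a₈ = p₂+q₂−p₀`".
[cite: BrownZudilin2022, Sect. 3 (display after (11))] -/
def aOfPQ (p : Fin 7 → ℤ) (q : Fin 5 → ℤ) : Fin 8 → ℤ :=
  ![q 3, q 4, q 1 + q 3 - q 2, q 0, q 1, p 2, p 4, p 2 + q 1 - p 0]

/-- Round trip `a ↦ (p(a); q(a)) ↦ a`. [cite: BrownZudilin2022, Sect. 3 (display after (11))] -/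
theorem aOfPQ_pOf_qOf (a : Fin 8 → ℤ) : aOfPQ (pOf a) (qOf a) = a := by
  ext i; fin_cases i <;> simp [aOfPQ, pOf, qOf] <;> ring

/-- Round trip `(p;q) ↦ a ↦ p` under the constraints (11) ("An integral of this form with 12 parameters reduces to `I(a)` if
and only if the parameters satisfy the constraints (11)" — the `if` direction at the level of parameters).
[cite: BrownZudilin2022, Sect. 3 eq. (11) and the display after it] -/
theorem pOf_aOfPQ {p : Fin 7 → ℤ} {q : Fin 5 → ℤ} (h : JConstraints p q) : pOf (aOfPQ p q) = p := by
  obtain ⟨h1, h3, h5, h6⟩ := h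
  ext i; fin_cases i <;> simp [aOfPQ, pOf] <;> linarith

/-- Round trip `(p;q) ↦ a ↦ q` (no constraint needed). [cite: BrownZudilin2022, Sect. 3 (display after (11))] -/
theorem qOf_aOfPQ (p : Fin 7 → ℤ) (q : Fin 5 → ℤ) : qOf (aOfPQ p q) = q := by
  ext i; fin_cases i <;> (simp [aOfPQ, qOf]; try ring)

/-- **(10) as a NAMED FACT** (statement only): the substitution before (10) "transforms the 8-parameter integral `I(a)` into
a subfamily of the … 12-parameter integrals" — the cubical integral (8) at `a` equals `J(p(a); q(a))`, for `a` in the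
convergence cone (3). The change of variables is not formalised here. [cite: BrownZudilin2022, Sect. 3 eq. (10)–(11)] -/
def cubicalIntegral_eq_Jintegral : Prop :=
  ∀ a : Fin 8 → ℤ, Converges a → cubicalIntegral a = Jintegral (pOf a) (qOf a)

/-- The lift (12) of `i₁` to the 12 parameters, on `p`: `p(i₁ a) = (p₆,p₅,p₄,p₃,p₂,p₁,p₀)(a)`.
[cite: BrownZudilin2022, Sect. 3 eq. (12)] -/
theorem pOf_genI1 (a : Fin 8 → ℤ) :
    pOf (genI1 a) = ![pOf a 6, pOf a 5, pOf a 4, pOf a 3, pOf a 2, pOf a 1, pOf a 0] := by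
  ext i; fin_cases i <;> simp [pOf, genI1] <;> ring

/-- The lift (12) of `i₁` to the 12 parameters, on `q`: `q(i₁ a) = (q₅,q₄,q₃,q₂,q₁)(a)`. [cite: BrownZudilin2022, Sect. 3 eq. (12)] -/
theorem qOf_genI1 (a : Fin 8 → ℤ) : qOf (genI1 a) = ![qOf a 4, qOf a 3, qOf a 2, qOf a 1, qOf a 0] := by
  ext i; fin_cases i <;> (simp [qOf, genI1]; try ring)

/-- "The change of variables `y_j ↦ y_{6−j}` for `j = 1,…,5` shows that the involution (9) naturally lifts to the 12-parameter
family as (12)": pointwise, the integrand (10) at the reversed parameters `(p₆,…,p₀; q₅,…,q₁)` is the integrand at `(p;q)`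
composed with the coordinate reversal. [cite: BrownZudilin2022, Sect. 3 eq. (10), (12)] -/
theorem integrandJ_reverse (p : Fin 7 → ℤ) (q : Fin 5 → ℤ) (y : Fin 5 → ℝ) :
    integrandJ ![p 6, p 5, p 4, p 3, p 2, p 1, p 0] ![q 4, q 3, q 2, q 1, q 0] y
      = integrandJ p q ![y 4, y 3, y 2, y 1, y 0] := by
  simp only [integrandJ, Matrix.cons_val_zero, Matrix.cons_val_one, Matrix.cons_val]
  have e1 : (1 : ℝ) - y 2 * (1 - y 4 * y 3) = 1 - y 2 * (1 - y 3 * y 4) := by ring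
  have e2 : (1 : ℝ) - y 2 * (1 - y 1 * y 0) = 1 - y 2 * (1 - y 0 * y 1) := by ring
  rw [e1, e2]
  ring

/-- Hence `J(p₆,…,p₀; q₅,…,q₁) = J(p;q)`: the lift (12) of the involution preserves the 12-parameter integral (10)
(for all parameters; change of variables `y_j ↦ y_{6−j}`). [cite: BrownZudilin2022, Sect. 3 eq. (10), (12)] -/
theorem Jintegral_reverse (p : Fin 7 → ℤ) (q : Fin 5 → ℤ) :
    Jintegral ![p 6, p 5, p 4, p 3, p 2, p 1, p 0] ![q 4, q 3, q 2, q 1, q 0] = Jintegral p q := by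
  unfold Jintegral
  simp_rw [integrandJ_reverse]
  exact setIntegral_openCube_reverse (integrandJ p q)

end Literature.NumberTheory.Irrationality.BrownZudilin2022
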